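import Mathlib.Analysis.Normed.Operator.NNNorm
import Mathlib.Analysis.Subadditive
import Mathlib.Analysis.SpecialFunctions.Log.Basic
import Literature.Analysis.ODE.EvolutionMap
import Literature.Analysis.ODE.EvolutionMapAutonomous
import Literature.Analysis.ODE.FloquetMultiplierGrowth
import HarnessLib

/-!
# Floquet theory for linear periodic systems, operator side: the propagator as a bounded operator,
# the monodromy OPERATOR, iteration over periods, and the Floquet (Lyapunov) growth exponent

Topic `Literature/Analysis/ODE` (namespace `Literature.Analysis.ODE.Floquet`). Everything is
PROVED; no named facts. Companion of `FloquetMultiplierGrowth.lean` (same namespace; solutions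
`Floquet.evolution hA x₀`, the monodromy as a linear map `Floquet.monodromy hA T : E →ₗ[ℝ] E`,
Floquet solutions of a real multiplier with their two-sided exponential law, and the bound on all
solutions GIVEN a power bound `‖Mⁿ x‖ ≤ C rⁿ ‖x‖`). For the linear system

  `x' = A(t) x`,  `A : ℝ → L(E, E)` continuous, `A(t + T) = A(t)`, `T > 0`

on a real Banach space `E` (Chicone, *Ordinary Differential Equations with Applications*, §2.4
"Floquet Theory", eq. (2.27); Hartman, *ODE*, Ch. IV §6 (6.1)–(6.2)), this file supplies the
OPERATOR-NORM side — what turns "the growth rate `σ`" of a periodic linear stability problem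
into a definition without any spectral input: the propagator as an element of the Banach algebra
`E →L[ℝ] E` (so that `‖Mⁿ‖` makes sense), the growth exponent `μ_F = inf_n log ‖Mⁿ‖/(nT)`, and
the theorems that `μ_F` bounds every solution and is sharp. Dictionary to the companion (§8,
by uniqueness of solutions): `propagator_zero_apply_eq_evolution` (`Φ(t, 0) x = evolution hA x t`),
`monodromyOp_apply_eq` / `coe_monodromyOp` (`(monodromyOp A T : E →ₗ[ℝ] E) = monodromy hA T`),
`monodromyOp_pow_apply_eq`; and (§9) `floquetExponent_le_of_norm_propagator_le` — an exponential
bound `‖Φ(t,0)‖ ≤ C e^{μt}` on the propagator (an energy estimate) gives `μ_F ≤ μ`.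

* **Propagator.** `propagator A t₀ t : E →L[ℝ] E`, the evolution map `x ↦ φ(t, t₀, x)` of the
  tree's `EvolutionMap.lean` for the field `(t, x) ↦ A t x`, as a bounded linear operator
  (linearity by uniqueness, boundedness by Grönwall); `propagator_self`, the group law
  `propagator_trans` (Chicone: "`t ↦ Φ(t)Φ⁻¹(τ)v`", Thm. 2.83 proof; Hartman (6.4)), invertibility,
  `hasDerivAt_propagator_apply`, and "every solution is the propagator applied to its initial
  value" (`propagator_apply_eq_of_hasDerivAt`).
* **Period shift and monodromy.** `propagator_add_period`: `Φ(t + T, t₀ + T) = Φ(t, t₀)`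
  (Chicone, proof of Thm. 2.83: "`Ψ(t) := Φ(t + T)` is a matrix solution"; Hartman (6.4)
  `Y(t + p) = Y(t) C`); `monodromyOp A T := propagator A 0 T` (Chicone: "the operator
  `v ↦ Φ(T + τ)Φ⁻¹(τ)v` is called a monodromy operator", here `τ = 0`); the ITERATION LAW
  `propagator_natMul_add`: `Φ(nT + τ, 0) = Φ(τ, 0) Mⁿ` (Chicone: "`Φ(t + 2T) = Φ(t) C²`");
  conjugacy of the monodromy operators at different base times (`propagator_period_conj`,
  Chicone Prop. 2.84 (2)).
* **Floquet growth exponent.** `floquetExponent A T := (inf_{n ≥ 1} (1/n) log ‖Mⁿ‖) / T` — the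
  largest "order number" `p⁻¹ Re log σ_j` of Hartman Ch. IV §6 / the largest real part of a
  characteristic exponent (Chicone, after Thm. 2.87; Prop. 2.101 "the real part of a Floquet
  exponent is a Lyapunov exponent"), written through operator norms so that no spectral theory
  is needed (in finite dimension `lim ‖Mⁿ‖^{1/n}` is the spectral radius of `M`; Gelfand); by
  Fekete's lemma the infimum is the limit (`tendsto_floquetExponent`).
  THEOREMS: `norm_propagator_apply_le_of_floquetExponent_lt` — for every `μ > μ_F` there is
  `C > 0` with `‖Φ(t, 0) x‖ ≤ C e^{μ t} ‖x‖` for all `t ≥ 0` and all `x` (Chicone Thm. 2.90 (1)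
  in quantitative form; the proof is his: iterate over periods and bound one period by
  Grönwall); the same for solutions (`norm_le_of_floquetExponent_lt`); SHARPNESS
  `exists_lt_norm_propagator_apply` — for `μ < μ_F` no such bound holds (Chicone Thm. 2.90 (3));
  the a-priori bound `floquetExponent_le_of_norm_le` (`μ_F ≤ sup ‖A‖`); and FLOQUET SOLUTIONS
  from a real characteristic multiplier, `propagator_apply_add_period_of_eigenvector`
  (`M x = ρ x ⇒ Φ(t + T) x = ρ Φ(t) x`, Chicone Thm. 2.95 "`x(t + T) = λ x(t)`"; Hartman:
  "`y = Y(t) y₀` is of the form `z₁(t) e^{λt}`"), `norm_propagator_apply_natMul_add_of_eigenvector`,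
  `log_abs_div_le_floquetExponent` (`log |ρ| / T ≤ μ_F`, Chicone Prop. 2.101).

Used by `FluidPDE/EllipticalInstabilityFloquet.lean` (Saffman, *Vortex Dynamics* §12.4
(12.4.8)–(12.4.9): "Floquet theory applies: `v = e^{σt} P(t)`, `σ = σ(α, Ω)`").

## Deliberately NOT here

The Floquet normal form `Φ(t) = P(t) e^{tB}` (Chicone Thm. 2.83 second half; Hartman Thm. 6.1
(6.3)) needs a logarithm of an invertible operator (Chicone Thm. 2.82, Jordan form), which Mathlib
lacks for general matrices; none of the growth statements above need it.

## References

* C. Chicone, *Ordinary Differential Equations with Applications*, 2nd ed., Texts in Applied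
  Mathematics 34, Springer (2006), §2.4 "Floquet Theory": eq. (2.27), Thm. 2.83 and its proof,
  the monodromy operator (between Thm. 2.83 and Prop. 2.84), Prop. 2.84, Thm. 2.90, Thm. 2.95,
  Def. 2.100 and Prop. 2.101 (held: `book:chiconend-ordinary-differential-equations-with-applications`,
  chunks p0200–p0216). [Chicone2006]
* P. Hartman, *Ordinary Differential Equations*, Classics in Applied Mathematics 38, SIAM (2002),
  Ch. IV §6 "Floquet theory", Thm. 6.1, eqs. (6.1)–(6.4) and the remark on characteristic roots /
  order numbers (held: `book:hartman2002-ordinary-differential-equations`, chunks p0064–p0065).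
  [Hartman2002]
* G. Teschl, *Ordinary Differential Equations and Dynamical Systems*, GSM 140, AMS (2012), §3.6
  (periodic linear systems). [Teschl2012]
* M. Fekete (1923) — subadditive lemma (Mathlib `Subadditive.tendsto_lim`). [folklore]
-/

noncomputable section

open Set Metric Filter Function Real
open scoped NNReal Topology

namespace Literature.Analysis.ODE

namespace Floquet

universe u

variable {E : Type u} [NormedAddCommGroup E] [NormedSpace ℝ E]

/-! ### §1 The linear field `(t, x) ↦ A t x` and its Cauchy–Lipschitz hypotheses -/

/-- The time-dependent vector field of the linear system `x' = A(t) x` (Chicone (2.27); Hartman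
(6.1)), in the format of the tree's `evolutionMap`. [cite: Chicone2006, §2.4 eq. (2.27)] -/
def linField (A : ℝ → E →L[ℝ] E) : ℝ → E → E := fun t x => A t x

/-- Unfolding the linear field. [cite: Chicone2006, §2.4 eq. (2.27)] -/
@[simp]
theorem linField_apply (A : ℝ → E →L[ℝ] E) (t : ℝ) (x : E) : linField A t x = A t x := rfl

/-- A continuous operator curve is bounded in operator norm on every compact set of times (the
form in which "`t ↦ A(t)` continuous" enters Chicone Thm. 2.4 / Hartman Ch. IV Lemma 1.1:
`|A(t)y| ≤ K|y|` on compact time sets). [cite: Hartman2002, Ch. IV §1 Lemma 1.1 (hypothesis)] -/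
theorem exists_norm_le_of_isCompact {A : ℝ → E →L[ℝ] E} (hA : Continuous A) {C : Set ℝ}
    (hC : IsCompact C) : ∃ K : ℝ≥0, ∀ t ∈ C, ‖A t‖ ≤ K := by
  obtain ⟨K, hK⟩ := hC.exists_bound_of_continuousOn hA.continuousOn
  refine ⟨⟨max K 0, le_max_right _ _⟩, fun t ht => ?_⟩
  exact (hK t ht).trans (le_max_left _ _)

/-- On a set of times where `‖A t‖ ≤ K`, the field `x ↦ A t x` is `K`-Lipschitz.
[cite: Chicone2006, §2.4 eq. (2.27)] -/
theorem lipschitzWith_linField {A : ℝ → E →L[ℝ] E} {K : ℝ≥0} {t : ℝ} (hK : ‖A t‖ ≤ K) :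
    LipschitzWith K (linField A t) :=
  (A t).lipschitz.weaken (by exact_mod_cast hK)

/-- **The linear system with continuous coefficients satisfies the Cauchy–Lipschitz hypotheses on
every set of times** (Chicone Thm. 2.4: solutions of `x' = A(t)x` exist wherever `A` is
continuous; Hartman Ch. IV Lemma 1.1). [cite: Chicone2006, §2.1 Thm. 2.4 and §2.4 eq. (2.27)] -/
theorem isUniformlyLipschitzOn_linField {A : ℝ → E →L[ℝ] E} (hA : Continuous A) (S : Set ℝ) :
    IsUniformlyLipschitzOn (linField A) S := by
  refine ⟨fun x => ?_, fun C hC _ => ?_⟩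
  · exact (hA.clm_apply continuous_const).continuousOn
  · obtain ⟨K, hK⟩ := exists_norm_le_of_isCompact hA hC
    exact ⟨K, fun t ht => lipschitzWith_linField (hK t ht)⟩

/-- A Lipschitz constant for the linear field between two times (Hartman Ch. IV Lemma 1.1:
`|A(t)y| ≤ K|y|` on `[a, b]`). [cite: Hartman2002, Ch. IV §1 Lemma 1.1 (hypothesis)] -/
theorem exists_lipschitzWith_linField_uIcc {A : ℝ → E →L[ℝ] E} (hA : Continuous A) (t₀ t : ℝ) :
    ∃ K : ℝ≥0, ∀ s ∈ uIcc t₀ t, LipschitzWith K (linField A s) := by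
  obtain ⟨K, hK⟩ := exists_norm_le_of_isCompact hA (isCompact_uIcc (a := t₀) (b := t))
  exact ⟨K, fun s hs => lipschitzWith_linField (hK s hs)⟩

/-- The unit of the operator ring acts as the identity (plumbing). [folklore] -/
private theorem clm_one_apply (x : E) : (1 : E →L[ℝ] E) x = x := rfl

/-- The product of the operator ring is composition (plumbing). [folklore] -/
private theorem clm_mul_apply (f g : E →L[ℝ] E) (x : E) : (f * g) x = f (g x) := rfl

variable [CompleteSpace E]

/-! ### §2 The propagator `Φ(t, t₀)` as a bounded linear operator -/

section Propagator

variable {A : ℝ → E →L[ℝ] E}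

/-- The evolution map of the linear field solves the equation (two-sided derivative, all times).
[cite: Chicone2006, §2.4 (after Thm. 2.83: "the vector solution … starting at time `t = τ`")] -/
theorem hasDerivAt_evolutionMap_linField (hA : Continuous A) (t₀ t : ℝ) (x : E) :
    HasDerivAt (fun s => evolutionMap (linField A) t₀ s x)
      (A t (evolutionMap (linField A) t₀ t x)) t :=
  (isUniformlyLipschitzOn_linField hA univ).hasDerivAt_evolutionMap convex_univ (mem_univ t₀)
    univ_mem x

omit [CompleteSpace E] in
/-- Uniqueness for the linear system on all of `ℝ`: a global solution is the evolution map of its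
value at any time. [cite: Chicone2006, §2.4, proof of Thm. 2.83 ("by the uniqueness of solutions")] -/
theorem evolutionMap_linField_eq_of_hasDerivAt (hA : Continuous A) {u : ℝ → E}
    (hu : ∀ s, HasDerivAt u (A s (u s)) s) (t₀ t : ℝ) :
    evolutionMap (linField A) t₀ t (u t₀) = u t :=
  (isUniformlyLipschitzOn_linField hA univ).evolutionMap_eq convex_univ (mem_univ t₀)
    (fun s _ => (hu s).hasDerivWithinAt) (mem_univ t)

/-- **Linearity of the evolution map in the initial value** (superposition; Chicone §2.1, the
solutions of a homogeneous linear system form a vector space): additivity. [cite: Chicone2006, §2.4 eq. (2.27)] -/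
theorem evolutionMap_linField_add (hA : Continuous A) (t₀ t : ℝ) (x y : E) :
    evolutionMap (linField A) t₀ t (x + y) =
      evolutionMap (linField A) t₀ t x + evolutionMap (linField A) t₀ t y := by
  have h := evolutionMap_linField_eq_of_hasDerivAt hA
    (u := fun s => evolutionMap (linField A) t₀ s x + evolutionMap (linField A) t₀ s y)
    (fun s => by
      simpa only [map_add] using
        (hasDerivAt_evolutionMap_linField hA t₀ s x).fun_add
          (hasDerivAt_evolutionMap_linField hA t₀ s y))
    t₀ t
  simpa only [evolutionMap_self] using h

/-- Linearity of the evolution map in the initial value: homogeneity. [cite: Chicone2006, §2.4 eq. (2.27)] -/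
theorem evolutionMap_linField_smul (hA : Continuous A) (t₀ t : ℝ) (c : ℝ) (x : E) :
    evolutionMap (linField A) t₀ t (c • x) = c • evolutionMap (linField A) t₀ t x := by
  have h := evolutionMap_linField_eq_of_hasDerivAt hA
    (u := fun s => c • evolutionMap (linField A) t₀ s x)
    (fun s => by
      simpa only [map_smul] using (hasDerivAt_evolutionMap_linField hA t₀ s x).fun_const_smul c)
    t₀ t
  simpa only [evolutionMap_self] using h

omit [CompleteSpace E] in
/-- The zero solution: `φ(t, t₀, 0) = 0`. [cite: Chicone2006, §2.4 eq. (2.27)] -/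
theorem evolutionMap_linField_zero (hA : Continuous A) (t₀ t : ℝ) :
    evolutionMap (linField A) t₀ t 0 = 0 :=
  (isUniformlyLipschitzOn_linField hA univ).evolutionMap_eq_self_of_forall_eq_zero convex_univ
    (fun s _ => by simp) (mem_univ t₀) (mem_univ t)

/-- **Grönwall bound for the linear system**: if `‖A s‖ ≤ K` between `t₀` and `t`, then
`‖φ(t, t₀, x)‖ ≤ ‖x‖ e^{K |t − t₀|}` (Hartman Ch. IV Lemma 1.1: "`|y(t)| ≤ e^{K|t−t₀|}|y₀|` if
`|A(t)y| ≤ K|y|`"). [cite: Hartman2002, Ch. IV §1 Lemma 1.1] -/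
theorem norm_evolutionMap_linField_le (hA : Continuous A) {t₀ t : ℝ} {K : ℝ≥0}
    (hK : ∀ s ∈ uIcc t₀ t, ‖A s‖ ≤ K) (x : E) :
    ‖evolutionMap (linField A) t₀ t x‖ ≤ ‖x‖ * exp (K * |t - t₀|) := by
  have h := (isUniformlyLipschitzOn_linField hA univ).dist_evolutionMap_le convex_univ
    (mem_univ t₀) (mem_univ t) (fun s hs => lipschitzWith_linField (hK s hs)) x 0
  rwa [evolutionMap_linField_zero hA, dist_zero_right, dist_zero_right] at h

open scoped Classical in
/-- **The propagator (principal solution operator) `Φ(t, t₀) : E →L[ℝ] E`** of `x' = A(t) x`: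
`x ↦ φ(t, t₀, x)`, the value at `t` of the solution through `x` at `t₀` — Chicone's
`v ↦ Φ(t)Φ⁻¹(τ)v`, Hartman's fundamental matrix normalised at `t₀`. A bounded linear operator
when `A` is continuous (linearity by uniqueness, boundedness by Grönwall); for discontinuous `A`
the junk value `1`. [cite: Chicone2006, §2.4 (after Thm. 2.83: the solution `t ↦ Φ(t)Φ⁻¹(τ)v`)] [cite: Hartman2002, Ch. IV §6 eq. (6.1)] -/
def propagator (A : ℝ → E →L[ℝ] E) (t₀ t : ℝ) : E →L[ℝ] E :=
  if hA : Continuous A then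
    LinearMap.mkContinuousOfExistsBound
      { toFun := evolutionMap (linField A) t₀ t
        map_add' := evolutionMap_linField_add hA t₀ t
        map_smul' := evolutionMap_linField_smul hA t₀ t }
      (by
        obtain ⟨K, hK⟩ := exists_norm_le_of_isCompact hA (isCompact_uIcc (a := t₀) (b := t))
        exact ⟨exp (K * |t - t₀|), fun x => by
          rw [mul_comm]; exact norm_evolutionMap_linField_le hA hK x⟩)
  else 1

/-- The propagator is the evolution map. [cite: Chicone2006, §2.4 (after Thm. 2.83)] -/
theorem propagator_apply (hA : Continuous A) (t₀ t : ℝ) (x : E) :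
    propagator A t₀ t x = evolutionMap (linField A) t₀ t x := by
  rw [propagator, dif_pos hA]
  rfl

/-- `Φ(t₀, t₀) = 1`. [cite: Chicone2006, §2.4, "principal fundamental matrix … at `t = 0`"] -/
@[simp]
theorem propagator_self (A : ℝ → E →L[ℝ] E) (t₀ : ℝ) : propagator A t₀ t₀ = 1 := by
  by_cases hA : Continuous A
  · ext x
    rw [propagator_apply hA, evolutionMap_self, clm_one_apply]
  · rw [propagator, dif_neg hA]

/-- **The propagator solves the equation**: `∂ₜ Φ(t, t₀) x = A(t) Φ(t, t₀) x`.
[cite: Chicone2006, §2.4 eq. (2.27)] -/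
theorem hasDerivAt_propagator_apply (hA : Continuous A) (t₀ t : ℝ) (x : E) :
    HasDerivAt (fun s => propagator A t₀ s x) (A t (propagator A t₀ t x)) t := by
  simp only [propagator_apply hA]
  exact hasDerivAt_evolutionMap_linField hA t₀ t x

/-- The orbits `t ↦ Φ(t, t₀) x` are continuous. [cite: Chicone2006, §2.4 eq. (2.27)] -/
theorem continuous_propagator_apply (hA : Continuous A) (t₀ : ℝ) (x : E) :
    Continuous fun s => propagator A t₀ s x :=
  continuous_iff_continuousAt.2 fun t => (hasDerivAt_propagator_apply hA t₀ t x).continuousAt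

/-- **Every global solution is the propagator applied to its value at any time**
(uniqueness; Chicone, proof of Thm. 2.83). [cite: Chicone2006, §2.4, proof of Thm. 2.83] -/
theorem propagator_apply_eq_of_hasDerivAt (hA : Continuous A) {u : ℝ → E}
    (hu : ∀ s, HasDerivAt u (A s (u s)) s) (t₀ t : ℝ) : propagator A t₀ t (u t₀) = u t := by
  rw [propagator_apply hA]
  exact evolutionMap_linField_eq_of_hasDerivAt hA hu t₀ t

/-- Solutions given only on a convex set of times `S` (one-sided derivatives at its ends, e.g.
`S = [0, ∞)`) are the propagator applied to their value at any `t₀ ∈ S`.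
[cite: Chicone2006, §2.4, proof of Thm. 2.83] -/
theorem propagator_apply_eq_of_hasDerivWithinAt (hA : Continuous A) {S : Set ℝ} (hS : Convex ℝ S)
    {u : ℝ → E} (hu : ∀ s ∈ S, HasDerivWithinAt u (A s (u s)) S s) {t₀ t : ℝ} (ht₀ : t₀ ∈ S)
    (ht : t ∈ S) : propagator A t₀ t (u t₀) = u t := by
  rw [propagator_apply hA]
  exact (isUniformlyLipschitzOn_linField hA S).evolutionMap_eq hS ht₀ hu ht

/-- **Group law** `Φ(t₂, t₁) Φ(t₁, t₀) = Φ(t₂, t₀)` (Chicone: `Φ(t)Φ⁻¹(τ)`; Hartman (6.4)).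
[cite: Chicone2006, §2.4 (after Thm. 2.83)] -/
theorem propagator_trans (hA : Continuous A) (t₀ t₁ t₂ : ℝ) :
    propagator A t₁ t₂ * propagator A t₀ t₁ = propagator A t₀ t₂ := by
  ext x
  rw [clm_mul_apply, propagator_apply hA, propagator_apply hA, propagator_apply hA]
  exact (isUniformlyLipschitzOn_linField hA univ).evolutionMap_trans convex_univ (mem_univ _)
    (mem_univ _) (mem_univ _) x

/-- Group law, applied form. [cite: Chicone2006, §2.4 (after Thm. 2.83)] -/
theorem propagator_apply_propagator_apply (hA : Continuous A) (t₀ t₁ t₂ : ℝ) (x : E) :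
    propagator A t₁ t₂ (propagator A t₀ t₁ x) = propagator A t₀ t₂ x := by
  rw [← clm_mul_apply, propagator_trans hA]

/-- **Every propagator is invertible**, with inverse the backward propagator (Chicone Prop. 2.84
(1): "every monodromy operator is invertible"). [cite: Chicone2006, §2.4 Prop. 2.84 (1)] -/
theorem propagator_mul_propagator_symm (hA : Continuous A) (t₀ t : ℝ) :
    propagator A t₀ t * propagator A t t₀ = 1 := by
  rw [propagator_trans hA, propagator_self]

end Propagator

/-! ### §3 Period shift, monodromy, iteration over periods -/

section Monodromy

variable {A : ℝ → E →L[ℝ] E} {T : ℝ}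

/-- **Period shift** `Φ(t + T, t₀ + T) = Φ(t, t₀)` for a `T`-periodic coefficient (Chicone, proof
of Thm. 2.83: "`Ψ(t) := Φ(t + T)` … is a matrix solution. Indeed `Ψ̇(t) = A(t + T)Φ(t + T) =
A(t)Ψ(t)`"; Hartman (6.4)). [cite: Chicone2006, §2.4, proof of Thm. 2.83] [cite: Hartman2002, Ch. IV §6 eq. (6.4)] -/
theorem propagator_add_period (hA : Continuous A) (hper : ∀ t, A (t + T) = A t) (t₀ t : ℝ) :
    propagator A (t₀ + T) (t + T) = propagator A t₀ t := by
  ext x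
  obtain ⟨K, hK⟩ := exists_lipschitzWith_linField_uIcc hA (t₀ + T) (t + T)
  have hshift : (fun s => linField A (s + T)) = linField A := by
    funext s x
    simp only [linField_apply, hper]
  rw [propagator_apply hA, propagator_apply hA, ← evolutionMap_comp_add_right T hK x, hshift]

/-- **The monodromy operator** `M = Φ(T, 0)` (Chicone §2.4: "the operator `v ↦ Φ(T + τ)Φ⁻¹(τ)v`
is called a monodromy operator … if `τ = 0` … `v ↦ Φ(T)Φ⁻¹(0)v`"; Hartman's `C` in (6.4)).
Its eigenvalues are the characteristic (Floquet) multipliers. [cite: Chicone2006, §2.4, monodromy operator (before Prop. 2.84)] [cite: Hartman2002, Ch. IV §6 eq. (6.4)] -/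
def monodromyOp (A : ℝ → E →L[ℝ] E) (T : ℝ) : E →L[ℝ] E := propagator A 0 T

/-- The monodromy operator is the propagator over one period from `0`.
[cite: Chicone2006, §2.4, monodromy operator (before Prop. 2.84)] -/
theorem monodromyOp_def (A : ℝ → E →L[ℝ] E) (T : ℝ) : monodromyOp A T = propagator A 0 T := rfl

/-- One period from any multiple of the period is the monodromy operator:
`Φ((n+1)T, nT) = M`. [cite: Chicone2006, §2.4, proof of Thm. 2.83] -/
theorem propagator_period (hA : Continuous A) (hper : ∀ t, A (t + T) = A t) (s : ℝ)
    (hs : ∃ n : ℕ, s = n * T) : propagator A s (s + T) = monodromyOp A T := by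
  obtain ⟨n, rfl⟩ := hs
  induction n with
  | zero => simp [monodromyOp_def]
  | succ n ih =>
    have e : ((n + 1 : ℕ) : ℝ) * T = n * T + T := by push_cast; ring
    rw [e, propagator_add_period hA hper, ih]

/-- **Iteration over periods** `Φ(nT + τ, 0) = Φ(τ, 0) Mⁿ` (Chicone, proof of Thm. 2.83:
"`Φ(t + T) = Φ(t) C`, `Φ(t + 2T) = Φ(t) C²`"; Hartman (6.4)).
[cite: Chicone2006, §2.4, proof of Thm. 2.83] [cite: Hartman2002, Ch. IV §6 eq. (6.4)] -/
theorem propagator_natMul_add (hA : Continuous A) (hper : ∀ t, A (t + T) = A t) (n : ℕ) (τ : ℝ) :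
    propagator A 0 (n * T + τ) = propagator A 0 τ * monodromyOp A T ^ n := by
  induction n generalizing τ with
  | zero => simp
  | succ n ih =>
    have e : ((n + 1 : ℕ) : ℝ) * T + τ = n * T + (τ + T) := by push_cast; ring
    have hshift : propagator A 0 (τ + T) = propagator A 0 τ * monodromyOp A T := by
      rw [← propagator_trans hA 0 T (τ + T), monodromyOp_def]
      congr 1
      simpa using propagator_add_period hA hper 0 τ
    rw [e, ih (τ + T), hshift, mul_assoc, ← pow_succ']

/-- `Φ(nT, 0) = Mⁿ`. [cite: Chicone2006, §2.4, proof of Thm. 2.83] -/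
theorem propagator_natMul (hA : Continuous A) (hper : ∀ t, A (t + T) = A t) (n : ℕ) :
    propagator A 0 (n * T) = monodromyOp A T ^ n := by
  simpa using propagator_natMul_add hA hper n 0

/-- **All monodromy operators are conjugate** (Chicone Prop. 2.84 (2): "`Ψ(T + τ)Ψ⁻¹(τ) =
Φ(τ)Φ(T)Φ⁻¹(τ)` … all monodromy operators have the same eigenvalues"):
`Φ(τ + T, τ) Φ(τ, 0) = Φ(τ, 0) M`. [cite: Chicone2006, §2.4 Prop. 2.84 (2)] -/
theorem propagator_period_conj (hA : Continuous A) (hper : ∀ t, A (t + T) = A t) (τ : ℝ) :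
    propagator A τ (τ + T) * propagator A 0 τ = propagator A 0 τ * monodromyOp A T := by
  rw [propagator_trans hA, ← propagator_trans hA 0 T (τ + T), monodromyOp_def]
  congr 1
  simpa using propagator_add_period hA hper 0 τ

/-- The monodromy operator is invertible (Chicone Prop. 2.84 (1)); its inverse is `Φ(0, T)`.
[cite: Chicone2006, §2.4 Prop. 2.84 (1)] -/
theorem monodromyOp_mul_propagator_symm (hA : Continuous A) :
    monodromyOp A T * propagator A T 0 = 1 :=
  propagator_mul_propagator_symm hA 0 T

/-- The backward propagator over one period is a left inverse of the monodromy operator.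
[cite: Chicone2006, §2.4 Prop. 2.84 (1)] -/
theorem propagator_symm_mul_monodromy (hA : Continuous A) :
    propagator A T 0 * monodromyOp A T = 1 :=
  propagator_mul_propagator_symm hA T 0

/-- Powers of the inverse undo powers of the monodromy operator. [cite: Chicone2006, §2.4 Prop. 2.84 (1)] -/
theorem propagator_symm_pow_mul_monodromy_pow (hA : Continuous A) (n : ℕ) :
    propagator A T 0 ^ n * monodromyOp A T ^ n = 1 := by
  induction n with
  | zero => simp
  | succ n ih =>
    rw [pow_succ, pow_succ', mul_assoc, ← mul_assoc (propagator A T 0),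
      propagator_symm_mul_monodromy hA, one_mul, ih]

/-- In a nontrivial space the powers of the monodromy operator have positive norm, quantitatively:
`1 ≤ ‖Φ(0,T)‖ⁿ ‖Mⁿ‖`. [cite: Chicone2006, §2.4 Prop. 2.84 (1)] -/
theorem one_le_norm_pow_mul_norm_monodromy_pow [Nontrivial E] (hA : Continuous A) (n : ℕ) :
    1 ≤ ‖propagator A T 0‖ ^ n * ‖monodromyOp A T ^ n‖ := by
  calc (1 : ℝ) = ‖(1 : E →L[ℝ] E)‖ := norm_one.symm
    _ = ‖propagator A T 0 ^ n * monodromyOp A T ^ n‖ := by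
        rw [propagator_symm_pow_mul_monodromy_pow hA]
    _ ≤ ‖propagator A T 0 ^ n‖ * ‖monodromyOp A T ^ n‖ := norm_mul_le _ _
    _ ≤ ‖propagator A T 0‖ ^ n * ‖monodromyOp A T ^ n‖ := by
        gcongr
        exact norm_pow_le _ _

/-- `‖Mⁿ‖ > 0` in a nontrivial space. [cite: Chicone2006, §2.4 Prop. 2.84 (1)] -/
theorem norm_monodromy_pow_pos [Nontrivial E] (hA : Continuous A) (n : ℕ) :
    0 < ‖monodromyOp A T ^ n‖ := by
  have h := one_le_norm_pow_mul_norm_monodromy_pow (T := T) hA n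
  rcases (norm_nonneg (monodromyOp A T ^ n)).eq_or_lt with h0 | h0
  · rw [← h0, mul_zero] at h; exact absurd h (by norm_num)
  · exact h0

/-- Lower bound `−n log ‖Φ(0,T)‖ ≤ log ‖Mⁿ‖`. [cite: Chicone2006, §2.4 Prop. 2.84 (1)] -/
theorem neg_mul_log_le_log_norm_monodromy_pow [Nontrivial E] (hA : Continuous A) (n : ℕ) :
    -(n * log ‖propagator A T 0‖) ≤ log ‖monodromyOp A T ^ n‖ := by
  have h := one_le_norm_pow_mul_norm_monodromy_pow (T := T) hA n
  have hpos := norm_monodromy_pow_pos (T := T) hA n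
  have hP : 0 < ‖propagator A T 0‖ ^ n := by
    rcases (pow_nonneg (norm_nonneg (propagator A T 0)) n).eq_or_lt with h0 | h0
    · rw [← h0, zero_mul] at h; exact absurd h (by norm_num)
    · exact h0
  have hlog : 0 ≤ log (‖propagator A T 0‖ ^ n * ‖monodromyOp A T ^ n‖) := log_nonneg h
  rw [log_mul hP.ne' hpos.ne', log_pow] at hlog
  linarith

end Monodromy

/-! ### §4 A-priori bounds over bounded time ranges -/

section Bounds

variable {A : ℝ → E →L[ℝ] E}

/-- **Grönwall bound for the propagator**: if `‖A s‖ ≤ K` between `t₀` and `t`, then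
`‖Φ(t, t₀)‖ ≤ e^{K|t − t₀|}` (Hartman Ch. IV Lemma 1.1). [cite: Hartman2002, Ch. IV §1 Lemma 1.1] -/
theorem norm_propagator_le_exp (hA : Continuous A) {t₀ t : ℝ} {K : ℝ≥0}
    (hK : ∀ s ∈ uIcc t₀ t, ‖A s‖ ≤ K) : ‖propagator A t₀ t‖ ≤ exp (K * |t - t₀|) := by
  refine ContinuousLinearMap.opNorm_le_bound _ (exp_pos _).le fun x => ?_
  rw [propagator_apply hA, mul_comm]
  exact norm_evolutionMap_linField_le hA hK x

/-- The propagators `Φ(τ, 0)`, `τ` in a compact time range, are uniformly bounded (by Grönwall;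
Chicone, proof of Thm. 2.90: "because `Q` is periodic, it is bounded"). [cite: Chicone2006, §2.4, proof of Thm. 2.90] -/
theorem exists_norm_propagator_le (hA : Continuous A) (a b : ℝ) :
    ∃ B : ℝ, 1 ≤ B ∧ ∀ τ ∈ Icc a b, ‖propagator A 0 τ‖ ≤ B := by
  obtain ⟨K, hK⟩ := exists_norm_le_of_isCompact hA
    (isCompact_Icc (a := min 0 a) (b := max 0 b))
  refine ⟨exp (K * max |a| |b|), one_le_exp (by positivity), fun τ hτ => ?_⟩
  have hsub : uIcc 0 τ ⊆ Icc (min 0 a) (max 0 b) := by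
    intro s hs
    rw [mem_uIcc] at hs
    constructor
    · rcases hs with ⟨h1, _⟩ | ⟨h1, _⟩
      · exact (min_le_left _ _).trans h1
      · exact (min_le_right _ _).trans (hτ.1.trans h1)
    · rcases hs with ⟨_, h2⟩ | ⟨_, h2⟩
      · exact h2.trans (hτ.2.trans (le_max_right _ _))
      · exact h2.trans (le_max_left _ _)
  refine (norm_propagator_le_exp hA fun s hs => hK s (hsub hs)).trans ?_
  gcongr
  rw [sub_zero]
  exact abs_le_max_abs_abs hτ.1 hτ.2

end Bounds

/-! ### §5 The Floquet growth exponent -/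

section Exponent

variable {A : ℝ → E →L[ℝ] E} {T : ℝ}

/-- **The Floquet (Lyapunov) growth exponent** of the `T`-periodic system `x' = A(t)x`:
`μ_F = (inf_{n ≥ 1} n⁻¹ log ‖Mⁿ‖) / T`, `M` the monodromy operator. In finite dimension
`lim ‖Mⁿ‖^{1/n}` is the spectral radius of `M` (the largest modulus of a characteristic
multiplier `σ_j`), so `μ_F = max_j T⁻¹ log |σ_j|` is the largest real part of a characteristic
exponent — Hartman's largest "order number `p⁻¹ Re log σ_j`" (Ch. IV §6), the largest Lyapunov
exponent of Chicone's Prop. 2.101; written through operator norms (no spectral theory needed; the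
infimum is a limit by Fekete, `tendsto_floquetExponent`). This is "the growth rate `σ`" of a
periodic linear stability problem (Saffman, *Vortex Dynamics* (12.4.8)–(12.4.9)).
[cite: Hartman2002, Ch. IV §6, characteristic roots and order numbers (after Thm. 6.1)] [cite: Chicone2006, §2.4 Def. 2.100 and Prop. 2.101] -/
def floquetExponent (A : ℝ → E →L[ℝ] E) (T : ℝ) : ℝ :=
  sInf ((fun n : ℕ => log ‖monodromyOp A T ^ n‖ / n) '' Ici 1) / T

/-- The set of normalised logarithms `n⁻¹ log ‖Mⁿ‖`, `n ≥ 1`, is nonempty (plumbing). [folklore] -/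
private theorem nonempty_image_log_norm_pow :
    ((fun n : ℕ => log ‖monodromyOp A T ^ n‖ / n) '' Ici 1).Nonempty :=
  ⟨_, 1, mem_Ici.2 le_rfl, rfl⟩

/-- The normalised logarithms `n⁻¹ log ‖Mⁿ‖` are bounded below (by `−log ‖Φ(0,T)‖`; by `0` in the
trivial space). [cite: Chicone2006, §2.4 Prop. 2.84 (1)] -/
theorem bddBelow_range_log_norm_pow (hA : Continuous A) :
    BddBelow (range fun n : ℕ => log ‖monodromyOp A T ^ n‖ / n) := by
  rcases subsingleton_or_nontrivial E with hE | hE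
  · refine ⟨0, ?_⟩
    rintro _ ⟨n, rfl⟩
    have : monodromyOp A T ^ n = 0 := Subsingleton.elim _ _
    simp [this]
  · refine ⟨min 0 (-log ‖propagator A T 0‖), ?_⟩
    rintro _ ⟨n, rfl⟩
    rcases Nat.eq_zero_or_pos n with hn | hn
    · subst hn; simp
    · have h := neg_mul_log_le_log_norm_monodromy_pow (T := T) hA n
      have hn' : (0 : ℝ) < n := by exact_mod_cast hn
      refine (min_le_right _ _).trans ?_
      rw [le_div_iff₀ hn']
      linarith

/-- The same lower bound on the image over `n ≥ 1` (plumbing). [folklore] -/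
private theorem bddBelow_image_log_norm_pow (hA : Continuous A) :
    BddBelow ((fun n : ℕ => log ‖monodromyOp A T ^ n‖ / n) '' Ici 1) :=
  (bddBelow_range_log_norm_pow hA).mono (image_subset_range _ _)

/-- **`μ_F ≤ log ‖Mⁿ‖ / (nT)` for every `n ≥ 1`** (the exponent is an infimum).
[cite: Hartman2002, Ch. IV §6, order numbers `p⁻¹ Re log σ_j`] -/
theorem floquetExponent_le_log_div (hA : Continuous A) (hT : 0 < T) {n : ℕ} (hn : 1 ≤ n) :
    floquetExponent A T ≤ log ‖monodromyOp A T ^ n‖ / (n * T) := by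
  rw [floquetExponent, ← div_div]
  exact div_le_div_of_nonneg_right (csInf_le (bddBelow_image_log_norm_pow hA) ⟨n, hn, rfl⟩) hT.le

/-- In particular `μ_F ≤ log ‖M‖ / T`. [cite: Hartman2002, Ch. IV §6] -/
theorem floquetExponent_le_log_norm_monodromy_div (hA : Continuous A) (hT : 0 < T) :
    floquetExponent A T ≤ log ‖monodromyOp A T‖ / T := by
  simpa using floquetExponent_le_log_div (A := A) hA hT le_rfl

/-- If `μ_F < μ` then some normalised logarithm is already below `μ`: `log ‖Mⁿ‖ / (nT) < μ`
(the exponent is an infimum of order numbers). [cite: Hartman2002, Ch. IV §6 (order numbers `p⁻¹ Re log σ_j`)] -/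
theorem exists_log_div_lt (hT : 0 < T) {μ : ℝ} (hμ : floquetExponent A T < μ) :
    ∃ n : ℕ, 1 ≤ n ∧ log ‖monodromyOp A T ^ n‖ / (n * T) < μ := by
  rw [floquetExponent, div_lt_iff₀ hT] at hμ
  obtain ⟨_, ⟨n, hn, rfl⟩, hlt⟩ := exists_lt_of_csInf_lt nonempty_image_log_norm_pow hμ
  refine ⟨n, hn, ?_⟩
  rwa [← div_div, div_lt_iff₀ hT]

/-- Lower bounds transfer to the infimum: if `μ ≤ log ‖Mⁿ‖ / (nT)` for all `n ≥ 1` then `μ ≤ μ_F`.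
[cite: Hartman2002, Ch. IV §6 (order numbers `p⁻¹ Re log σ_j`)] -/
theorem le_floquetExponent (hT : 0 < T) {μ : ℝ}
    (h : ∀ n : ℕ, 1 ≤ n → μ ≤ log ‖monodromyOp A T ^ n‖ / (n * T)) : μ ≤ floquetExponent A T := by
  rw [floquetExponent, le_div_iff₀ hT]
  refine le_csInf nonempty_image_log_norm_pow ?_
  rintro _ ⟨n, hn, rfl⟩
  have := h n hn
  rwa [← div_div, le_div_iff₀ hT] at this

/-- **A-priori bound `μ_F ≤ sup_{[0,T]} ‖A‖`**: the growth exponent never exceeds the size of the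
coefficient (Grönwall over one period: `‖M‖ ≤ e^{KT}`). [cite: Hartman2002, Ch. IV §1 Lemma 1.1 and §6] -/
theorem floquetExponent_le_of_norm_le (hA : Continuous A) (hT : 0 < T) {K : ℝ≥0}
    (hK : ∀ t ∈ Icc 0 T, ‖A t‖ ≤ K) : floquetExponent A T ≤ K := by
  refine (floquetExponent_le_log_norm_monodromy_div hA hT).trans ?_
  rw [div_le_iff₀ hT]
  have hM : ‖monodromyOp A T‖ ≤ exp (K * T) := by
    have h := norm_propagator_le_exp hA (t₀ := 0) (t := T) (K := K)
      (fun s hs => hK s (by rwa [uIcc_of_le hT.le] at hs))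
    simpa [monodromyOp_def, abs_of_pos hT] using h
  rcases (norm_nonneg (monodromyOp A T)).eq_or_lt with h0 | h0
  · rw [← h0, log_zero]; positivity
  · exact (log_le_iff_le_exp h0).2 hM

/-- **Fekete: the infimum is the limit**, `n⁻¹ T⁻¹ log ‖Mⁿ‖ → μ_F` (in a nontrivial space, where
`n ↦ log ‖Mⁿ‖` is subadditive because `‖M^{m+n}‖ ≤ ‖Mᵐ‖ ‖Mⁿ‖`).
[cite: Chicone2006, §2.4 Prop. 2.101 (the `limsup` defining a Lyapunov exponent)] -/
theorem tendsto_floquetExponent [Nontrivial E] (hA : Continuous A) (T : ℝ) :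
    Tendsto (fun n : ℕ => log ‖monodromyOp A T ^ n‖ / n / T) atTop (𝓝 (floquetExponent A T)) := by
  have hsub : Subadditive fun n : ℕ => log ‖monodromyOp A T ^ n‖ := by
    intro m n
    have hm := norm_monodromy_pow_pos (T := T) hA m
    have hn := norm_monodromy_pow_pos (T := T) hA n
    have hmn := norm_monodromy_pow_pos (T := T) hA (m + n)
    rw [← log_mul hm.ne' hn.ne', log_le_log_iff hmn (mul_pos hm hn), pow_add]
    exact norm_mul_le _ _
  have h := (hsub.tendsto_lim (bddBelow_range_log_norm_pow hA)).div_const T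
  have e : hsub.lim / T = floquetExponent A T := by
    rw [Subadditive.lim, floquetExponent]
  rwa [e] at h

end Exponent

/-! ### §6 Exponential bounds on all solutions, and their sharpness -/

section Growth

variable {A : ℝ → E →L[ℝ] E} {T : ℝ}

/-- Euclidean division of a time `t ≥ 0` by a period `P > 0`: `t = k P + τ`, `k ∈ ℕ`, `0 ≤ τ < P`
(Chicone, proof of Prop. 2.101: "there is a nonnegative integer `n` and a number `r` such that
`0 ≤ r < T` and …"). [cite: Chicone2006, §2.4, proof of Prop. 2.101] -/
theorem exists_nat_mul_add_of_nonneg {P t : ℝ} (hP : 0 < P) (ht : 0 ≤ t) :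
    ∃ (k : ℕ) (τ : ℝ), 0 ≤ τ ∧ τ < P ∧ t = k * P + τ := by
  refine ⟨⌊t / P⌋₊, t - ⌊t / P⌋₊ * P, ?_, ?_, by ring⟩
  · have h := Nat.floor_le (div_nonneg ht hP.le)
    rw [le_div_iff₀ hP] at h
    linarith
  · have h := Nat.lt_floor_add_one (t / P)
    rw [div_lt_iff₀ hP] at h
    linarith

/-- **Exponential bound on the propagator above the Floquet exponent** (Chicone Thm. 2.90 (1) in
quantitative form; Hartman: solutions have order number at most `max_j p⁻¹ Re log σ_j`): for every
`μ > μ_F` there is `C > 0` with `‖Φ(t, 0) x‖ ≤ C e^{μt} ‖x‖` for all `t ≥ 0`, `x ∈ E`. Proof as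
in Chicone: pick `n` with `‖Mⁿ‖ < e^{μ n T}`, write `t = k(nT) + τ`, `Φ(t,0) = Φ(τ,0)(Mⁿ)ᵏ`, and
bound `Φ(τ, 0)` over one (long) period by Grönwall. [cite: Chicone2006, §2.4 Thm. 2.90 (1) and its proof] [cite: Hartman2002, Ch. IV §6 (order numbers)] -/
theorem norm_propagator_apply_le_of_floquetExponent_lt (hA : Continuous A) (hT : 0 < T)
    (hper : ∀ t, A (t + T) = A t) {μ : ℝ} (hμ : floquetExponent A T < μ) :
    ∃ C : ℝ, 0 < C ∧ ∀ x : E, ∀ t : ℝ, 0 ≤ t → ‖propagator A 0 t x‖ ≤ C * exp (μ * t) * ‖x‖ := by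
  obtain ⟨n, hn, hlt⟩ := exists_log_div_lt hT hμ
  have hn0 : (0 : ℝ) < n := by exact_mod_cast hn
  set P : ℝ := n * T with hP
  have hPpos : 0 < P := mul_pos hn0 hT
  -- the long period `P = nT` and its monodromy `Mⁿ`
  have hperP : ∀ t, A (t + P) = A t := fun t => by
    have h : Function.Periodic A T := hper
    exact h.nat_mul n t
  have hMP : monodromyOp A P = monodromyOp A T ^ n := by
    rw [monodromyOp_def, hP, propagator_natMul hA hper n]
  have hq : ‖monodromyOp A P‖ ≤ exp (μ * P) := by
    rw [hMP]
    rcases (norm_nonneg (monodromyOp A T ^ n)).eq_or_lt with h0 | h0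
    · rw [← h0]; positivity
    · rw [div_lt_iff₀ (mul_pos hn0 hT)] at hlt
      exact ((log_lt_iff_lt_exp h0).1 (by rwa [hP])).le
  obtain ⟨B, hB1, hB⟩ := exists_norm_propagator_le hA 0 P
  have hB0 : 0 ≤ B := zero_le_one.trans hB1
  -- `‖(M_P)ᵏ y‖ ≤ ‖M_P‖ᵏ ‖y‖`
  have hy : ∀ (k : ℕ) (y : E), ‖(monodromyOp A P ^ k) y‖ ≤ ‖monodromyOp A P‖ ^ k * ‖y‖ := by
    intro k
    induction k with
    | zero => intro y; simp
    | succ k ih =>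
      intro y
      rw [pow_succ, clm_mul_apply]
      calc ‖(monodromyOp A P ^ k) (monodromyOp A P y)‖
          ≤ ‖monodromyOp A P‖ ^ k * ‖monodromyOp A P y‖ := ih _
        _ ≤ ‖monodromyOp A P‖ ^ k * (‖monodromyOp A P‖ * ‖y‖) := by
            gcongr; exact ContinuousLinearMap.le_opNorm _ _
        _ = ‖monodromyOp A P‖ ^ (k + 1) * ‖y‖ := by ring
  refine ⟨B * exp (|μ| * P), by positivity, fun x t ht => ?_⟩
  obtain ⟨k, τ, hτ0, hτP, rfl⟩ := exists_nat_mul_add_of_nonneg hPpos ht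
  rw [propagator_natMul_add hA hperP k τ, clm_mul_apply]
  have h2 : ‖(monodromyOp A P ^ k) x‖ ≤ exp (μ * (k * P)) * ‖x‖ := by
    refine (hy k x).trans (mul_le_mul_of_nonneg_right ?_ (norm_nonneg _))
    calc ‖monodromyOp A P‖ ^ k ≤ exp (μ * P) ^ k := by gcongr
      _ = exp (μ * (k * P)) := by rw [← Real.exp_nat_mul]; ring_nf
  have h3 : exp (μ * (k * P)) ≤ exp (|μ| * P) * exp (μ * (k * P + τ)) := by
    rw [← exp_add, exp_le_exp]
    have h4 : -(μ * τ) ≤ |μ| * P :=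
      calc -(μ * τ) ≤ |μ * τ| := neg_le_abs _
        _ = |μ| * τ := by rw [abs_mul, abs_of_nonneg hτ0]
        _ ≤ |μ| * P := by gcongr
    linarith
  calc ‖propagator A 0 τ ((monodromyOp A P ^ k) x)‖
      ≤ ‖propagator A 0 τ‖ * ‖(monodromyOp A P ^ k) x‖ := ContinuousLinearMap.le_opNorm _ _
    _ ≤ B * (exp (μ * (k * P)) * ‖x‖) :=
        mul_le_mul (hB τ ⟨hτ0, hτP.le⟩) h2 (norm_nonneg _) hB0
    _ ≤ B * (exp (|μ| * P) * exp (μ * (k * P + τ)) * ‖x‖) := by gcongr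
    _ = B * exp (|μ| * P) * exp (μ * (k * P + τ)) * ‖x‖ := by ring

/-- **Exponential bound on every solution above the Floquet exponent**: for `μ > μ_F` there is
`C > 0` such that every global solution satisfies `‖u(t)‖ ≤ C e^{μt} ‖u(0)‖`, `t ≥ 0` (Chicone
Thm. 2.90 (1); Hartman Ch. IV §6). [cite: Chicone2006, §2.4 Thm. 2.90 (1)] [cite: Hartman2002, Ch. IV §6 (order numbers)] -/
theorem norm_le_of_floquetExponent_lt (hA : Continuous A) (hT : 0 < T)
    (hper : ∀ t, A (t + T) = A t) {μ : ℝ} (hμ : floquetExponent A T < μ) :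
    ∃ C : ℝ, 0 < C ∧ ∀ u : ℝ → E, (∀ s, HasDerivAt u (A s (u s)) s) →
      ∀ t : ℝ, 0 ≤ t → ‖u t‖ ≤ C * exp (μ * t) * ‖u 0‖ := by
  obtain ⟨C, hC, h⟩ := norm_propagator_apply_le_of_floquetExponent_lt hA hT hper hμ
  refine ⟨C, hC, fun u hu t ht => ?_⟩
  rw [← propagator_apply_eq_of_hasDerivAt hA hu 0 t]
  exact h (u 0) t ht

/-- The same for solutions given on `[0, ∞)` only (right derivative at `0`).
[cite: Chicone2006, §2.4 Thm. 2.90 (1)] -/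
theorem norm_le_of_floquetExponent_lt_Ici (hA : Continuous A) (hT : 0 < T)
    (hper : ∀ t, A (t + T) = A t) {μ : ℝ} (hμ : floquetExponent A T < μ) :
    ∃ C : ℝ, 0 < C ∧ ∀ u : ℝ → E, (∀ s ∈ Ici (0:ℝ), HasDerivWithinAt u (A s (u s)) (Ici 0) s) →
      ∀ t : ℝ, 0 ≤ t → ‖u t‖ ≤ C * exp (μ * t) * ‖u 0‖ := by
  obtain ⟨C, hC, h⟩ := norm_propagator_apply_le_of_floquetExponent_lt hA hT hper hμ
  refine ⟨C, hC, fun u hu t ht => ?_⟩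
  rw [← propagator_apply_eq_of_hasDerivWithinAt hA (convex_Ici 0) hu (mem_Ici.2 le_rfl)
    (mem_Ici.2 ht)]
  exact h (u 0) t ht

/-- **Sharpness below the Floquet exponent** (Chicone Thm. 2.90 (3): a multiplier outside the
closed unit disc makes the zero solution unstable; here in norm form): for `μ < μ_F` and any `C`
there are `x` and `n` with `‖Φ(nT, 0) x‖ > C e^{μ nT} ‖x‖` — no bound `C e^{μt}` holds for all
solutions. [cite: Chicone2006, §2.4 Thm. 2.90 (3)] -/
theorem exists_lt_norm_propagator_apply [Nontrivial E] (hA : Continuous A) (hT : 0 < T)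
    (hper : ∀ t, A (t + T) = A t) {μ : ℝ} (hμ : μ < floquetExponent A T) (C : ℝ) :
    ∃ (x : E) (n : ℕ), C * exp (μ * (n * T)) * ‖x‖ < ‖propagator A 0 (n * T) x‖ := by
  rcases le_or_gt C 0 with hC | hC
  · obtain ⟨x, hx⟩ := exists_ne (0 : E)
    refine ⟨x, 0, ?_⟩
    have hxpos : 0 < ‖x‖ := norm_pos_iff.2 hx
    simp only [Nat.cast_zero, zero_mul, mul_zero, exp_zero, mul_one, propagator_self, clm_one_apply]
    nlinarith
  · set δ : ℝ := floquetExponent A T - μ with hδ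
    have hδpos : 0 < δ := by rw [hδ]; linarith
    obtain ⟨N, hN⟩ := exists_nat_gt (log C / (δ * T))
    set n : ℕ := N + 1 with hn
    have hn1 : 1 ≤ n := by rw [hn]; omega
    have hnN : (N : ℝ) < n := by rw [hn]; push_cast; linarith
    have hnT : 0 < (n : ℝ) * T := mul_pos (by exact_mod_cast hn1) hT
    -- `C e^{μ n T} < e^{μ_F n T} ≤ ‖Mⁿ‖`
    have hClt : C < exp (δ * (n * T)) := by
      rw [← exp_log hC, exp_lt_exp]
      have h1 : log C < N * (δ * T) := (div_lt_iff₀ (mul_pos hδpos hT)).1 hN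
      nlinarith [mul_pos hδpos hT]
    have hMn : exp (floquetExponent A T * (n * T)) ≤ ‖monodromyOp A T ^ n‖ := by
      rw [← le_log_iff_exp_le (norm_monodromy_pow_pos hA n), ← le_div_iff₀ hnT]
      exact floquetExponent_le_log_div hA hT hn1
    have hr : C * exp (μ * (n * T)) < ‖propagator A 0 (n * T)‖ := by
      rw [propagator_natMul hA hper n]
      refine lt_of_lt_of_le ?_ hMn
      have e : exp (floquetExponent A T * (n * T)) = exp (δ * (n * T)) * exp (μ * (n * T)) := by
        rw [← exp_add, hδ]; ring_nf
      rw [e]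
      exact mul_lt_mul_of_pos_right hClt (exp_pos _)
    obtain ⟨x, hx1, hx⟩ := (propagator A 0 (n * T)).exists_lt_apply_of_lt_opNorm hr
    refine ⟨x, n, lt_of_le_of_lt ?_ hx⟩
    have hpos : 0 < C * exp (μ * (n * T)) := mul_pos hC (exp_pos _)
    nlinarith [norm_nonneg x]

end Growth

/-! ### §7 Floquet solutions from a real characteristic multiplier -/

section Eigen

variable {A : ℝ → E →L[ℝ] E} {T ρ : ℝ} {x : E}

/-- **Floquet solutions** (Chicone Thm. 2.95: "if `λ` is a characteristic multiplier … there is a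
nontrivial solution … `x(t + T) = λ x(t)`"; Hartman: "if `y₀` is an eigenvector … the solution
`y = Y(t) y₀` is of the form `z₁(t) e^{λt}`"), real-multiplier case: if `M x = ρ x` then the
solution through `x` satisfies `Φ(t + T, 0) x = ρ Φ(t, 0) x`. [cite: Chicone2006, §2.4 Thm. 2.95] [cite: Hartman2002, Ch. IV §6 Thm. 6.1 (remark)] -/
theorem propagator_apply_add_period_of_eigenvector (hA : Continuous A)
    (hper : ∀ t, A (t + T) = A t) (hx : monodromyOp A T x = ρ • x) (t : ℝ) :
    propagator A 0 (t + T) x = ρ • propagator A 0 t x := by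
  have h : propagator A 0 (t + T) = propagator A 0 t * monodromyOp A T := by
    rw [← propagator_trans hA 0 T (t + T), monodromyOp_def]
    congr 1
    simpa using propagator_add_period hA hper 0 t
  rw [h, clm_mul_apply, hx, map_smul]

/-- Powers of the multiplier: `Mⁿ x = ρⁿ x`. [cite: Chicone2006, §2.4 Thm. 2.95] -/
theorem monodromyOp_pow_apply_of_eigenvector (hx : monodromyOp A T x = ρ • x) (n : ℕ) :
    (monodromyOp A T ^ n) x = ρ ^ n • x := by
  induction n with
  | zero => simp
  | succ n ih => rw [pow_succ, clm_mul_apply, hx, map_smul, ih, smul_smul, pow_succ']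

/-- Along a Floquet solution the norm is multiplied by `|ρ|` each period:
`‖Φ(nT + τ, 0) x‖ = |ρ|ⁿ ‖Φ(τ, 0) x‖`. [cite: Chicone2006, §2.4 Thm. 2.95 and Prop. 2.101 (proof)] -/
theorem norm_propagator_apply_natMul_add_of_eigenvector (hA : Continuous A)
    (hper : ∀ t, A (t + T) = A t) (hx : monodromyOp A T x = ρ • x) (n : ℕ) (τ : ℝ) :
    ‖propagator A 0 (n * T + τ) x‖ = |ρ| ^ n * ‖propagator A 0 τ x‖ := by
  rw [propagator_natMul_add hA hper n τ, clm_mul_apply, monodromyOp_pow_apply_of_eigenvector hx,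
    map_smul, norm_smul, norm_pow, Real.norm_eq_abs]

/-- **A real characteristic multiplier bounds the Floquet exponent from below**:
`M x = ρ x`, `x ≠ 0` ⇒ `log |ρ| / T ≤ μ_F` (Chicone Prop. 2.101: "the real part of a Floquet
exponent is a Lyapunov exponent"; Hartman: order number `p⁻¹ Re log σ_j`).
[cite: Chicone2006, §2.4 Prop. 2.101] [cite: Hartman2002, Ch. IV §6 (order numbers)] -/
theorem log_abs_div_le_floquetExponent (hA : Continuous A) (hT : 0 < T)
    (hx : monodromyOp A T x = ρ • x) (hx0 : x ≠ 0) : log |ρ| / T ≤ floquetExponent A T := by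
  haveI : Nontrivial E := ⟨⟨x, 0, hx0⟩⟩
  have hxpos : 0 < ‖x‖ := norm_pos_iff.2 hx0
  -- `ρ ≠ 0`: the monodromy operator is injective
  have hρ : ρ ≠ 0 := by
    intro h0
    rw [h0, zero_smul] at hx
    have h1 : (propagator A T 0 * monodromyOp A T) x = x := by
      rw [propagator_symm_mul_monodromy hA, clm_one_apply]
    rw [clm_mul_apply, hx, map_zero] at h1
    exact hx0 h1.symm
  refine le_floquetExponent hT fun n hn => ?_
  have hn0 : (0 : ℝ) < n := by exact_mod_cast hn
  rw [← mul_div_mul_left (log |ρ|) T hn0.ne']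
  refine div_le_div_of_nonneg_right ?_ (mul_pos hn0 hT).le
  -- `|ρ|ⁿ ‖x‖ = ‖Mⁿ x‖ ≤ ‖Mⁿ‖ ‖x‖`
  have hle : |ρ| ^ n ≤ ‖monodromyOp A T ^ n‖ := by
    have h := ContinuousLinearMap.le_opNorm (monodromyOp A T ^ n) x
    rw [monodromyOp_pow_apply_of_eigenvector hx, norm_smul, norm_pow, Real.norm_eq_abs] at h
    exact le_of_mul_le_mul_right h hxpos
  rw [← log_pow]
  exact log_le_log (pow_pos (abs_pos.2 hρ) n) hle

end Eigen

/-! ### §8 Dictionary to `FloquetMultiplierGrowth.lean` (the companion's solution operator) -/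

section Dictionary

variable {A : ℝ → E →L[ℝ] E} {T : ℝ}

/-- **The propagator from time `0` is the companion file's solution operator**:
`Φ(t, 0) x = Floquet.evolution hA x t` (both are THE solution through `x` at `t = 0`).
[cite: Chicone2006, §2.4 (after Thm. 2.83: the solution `t ↦ Φ(t)Φ⁻¹(τ)v`)] -/
theorem propagator_zero_apply_eq_evolution (hA : Continuous A) (t : ℝ) (x : E) :
    propagator A 0 t x = evolution hA x t := by
  have h := eq_evolution hA (v := fun s => propagator A 0 s x)
    (fun s => hasDerivAt_propagator_apply hA 0 s x)
  have h0 : propagator A 0 0 x = x := by rw [propagator_self, clm_one_apply]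
  simpa [h0] using congrFun h t

/-- **The monodromy operator coincides with the companion file's monodromy linear map**,
pointwise. [cite: Chicone2006, §2.4, monodromy operator (before Prop. 2.84)] -/
theorem monodromyOp_apply_eq (hA : Continuous A) (T : ℝ) (x : E) :
    monodromyOp A T x = monodromy hA T x := by
  rw [monodromy_apply, monodromyOp_def, propagator_zero_apply_eq_evolution hA]

/-- The same as an identity of linear maps: `(monodromyOp A T : E →ₗ[ℝ] E) = monodromy hA T`.
[cite: Chicone2006, §2.4, monodromy operator (before Prop. 2.84)] -/
theorem coe_monodromyOp (hA : Continuous A) (T : ℝ) :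
    (monodromyOp A T : E →ₗ[ℝ] E) = monodromy hA T :=
  LinearMap.ext (monodromyOp_apply_eq hA T)

/-- Powers agree too: `(monodromyOp A T ^ n) x = (monodromy hA T ^ n) x`.
[cite: Chicone2006, §2.4 Thm. 2.83 (proof: `Φ(t + 2T) = Φ(t) C²`)] -/
theorem monodromyOp_pow_apply_eq (hA : Continuous A) (T : ℝ) (n : ℕ) (x : E) :
    (monodromyOp A T ^ n) x = (monodromy hA T ^ n) x := by
  induction n generalizing x with
  | zero => simp
  | succ n ih =>
    rw [pow_succ, clm_mul_apply, monodromyOp_apply_eq hA, ih, pow_succ, Module.End.mul_apply]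

end Dictionary

/-! ### §9 Reading the exponent off an exponential bound on the propagator -/

section FromBound

variable {A : ℝ → E →L[ℝ] E} {T : ℝ}

/-- **An exponential bound on the propagator bounds the Floquet exponent**: in a nontrivial space,
if `‖Φ(t, 0)‖ ≤ C e^{μt}` for all `t ≥ 0` then `μ_F ≤ μ` (take `t = nT`: `log ‖Mⁿ‖/(nT) ≤
μ + log C/(nT)`, and let `n → ∞`). This is how an a-priori (energy) estimate on all solutions —
e.g. a strain-rate ceiling — becomes a bound on the largest order number.
[cite: Hartman2002, Ch. IV §6 (order numbers `p⁻¹ Re log σ_j`)] [cite: Chicone2006, §2.4 Prop. 2.101] -/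
theorem floquetExponent_le_of_norm_propagator_le [Nontrivial E] (hA : Continuous A) (hT : 0 < T)
    (hper : ∀ t, A (t + T) = A t) {C μ : ℝ}
    (h : ∀ t : ℝ, 0 ≤ t → ‖propagator A 0 t‖ ≤ C * exp (μ * t)) : floquetExponent A T ≤ μ := by
  have hC1 : 1 ≤ C := by simpa using h 0 le_rfl
  have hC : 0 < C := zero_lt_one.trans_le hC1
  refine le_of_forall_pos_le_add fun η hη => ?_
  -- choose `n ≥ 1` with `log C / (n T) ≤ η`
  obtain ⟨N, hN⟩ := exists_nat_gt (log C / (η * T))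
  set n : ℕ := N + 1 with hn
  have hn1 : 1 ≤ n := by rw [hn]; omega
  have hnpos : (0 : ℝ) < n := by exact_mod_cast hn1
  have hnT : 0 < (n : ℝ) * T := mul_pos hnpos hT
  have hNn : (N : ℝ) < n := by rw [hn]; push_cast; linarith
  have hlogC : log C ≤ η * (n * T) := by
    have h1 : log C < N * (η * T) := (div_lt_iff₀ (mul_pos hη hT)).1 hN
    nlinarith [mul_pos hη hT, log_nonneg hC1]
  refine (floquetExponent_le_log_div hA hT hn1).trans ?_
  rw [div_le_iff₀ hnT]
  have hM : ‖monodromyOp A T ^ n‖ ≤ C * exp (μ * (n * T)) := by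
    rw [← propagator_natMul hA hper n]
    exact h _ hnT.le
  have hpos := norm_monodromy_pow_pos (T := T) hA n
  calc log ‖monodromyOp A T ^ n‖ ≤ log (C * exp (μ * (n * T))) := log_le_log hpos hM
    _ = log C + μ * (n * T) := by rw [log_mul hC.ne' (exp_pos _).ne', log_exp]
    _ ≤ (μ + η) * (n * T) := by nlinarith

/-- The same from a pointwise bound `‖Φ(t, 0) x‖ ≤ C e^{μt} ‖x‖` (`C ≥ 0`), the form an energy
estimate delivers. [cite: Hartman2002, Ch. IV §6 (order numbers)] [cite: Chicone2006, §2.4 Prop. 2.101] -/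
theorem floquetExponent_le_of_norm_propagator_apply_le [Nontrivial E] (hA : Continuous A)
    (hT : 0 < T) (hper : ∀ t, A (t + T) = A t) {C μ : ℝ} (hC : 0 ≤ C)
    (h : ∀ (x : E) (t : ℝ), 0 ≤ t → ‖propagator A 0 t x‖ ≤ C * exp (μ * t) * ‖x‖) :
    floquetExponent A T ≤ μ :=
  floquetExponent_le_of_norm_propagator_le hA hT hper fun t ht =>
    ContinuousLinearMap.opNorm_le_bound _ (by positivity) fun x => h x t ht

end FromBound

end Floquet

end Literature.Analysis.ODE

end
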